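import Summits.CriticalPhenomena.PercolationContinuityZ3.Theorems.Transplant.DecoratedSlabNeg
import HarnessLib

/-!
# Automorphisms of the x-decorated two-layer slab act affinely on the plane, I: edge types and the `y`-coordinate (refuter's row 30, part 1/2)

builds on p205010 (kernel theorem, internal audit signed; external expert review pending) — nothing in this file uses p205010.
Lane `prim-bschramm`, seat `prim-bschramm-p5` (gen 5; METHOD = counterexample / sharpness search; memo `HOME/bschramm/P5-SHARPNESS.md` §22.2, row 30);
helper file (`--supports stmt-CriticalPhenomena-4575 --as helper`).  Part 2 (`DecoratedSlabNoConc`) concludes `IsEmpty (PlanarSkeletonConc dsGraph)`.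

For `D = Cay(ℤ² × ℤ/2; ±e₀, ±e₁, f, ±e₀+f)` (p4-g6's `dsGraph`, p237334):
* §1 intrinsic edge types (finite checks by `decide` over the 7 generators): the `±e₁`-edges are exactly the edges with NO common neighbour
  (`gens_sub_ne_Yg`, `gens_common_of_ne_Yg`); the rung `f` has two distinct NON-adjacent common neighbours (`rung_facts`); for the four
  `x`-type generators all common neighbours are pairwise adjacent (`gens_xtype_common_adj`);
* §2 hence every automorphism `α` maps `e₁`-steps to `±e₁`-steps (`step_Yg`) with ONE global sign (`step_Yg_const`, by injectivity along a
  line and a 4-cycle across), non-`e₁` steps keep the `y`-coordinate (`snd_step_of_ne_Yg`), and the `y`-coordinate is affine under `α`: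
  **`snd_aut_affine`** `y(α w) − y(α t) = σ (y w − y t)`, `σ = ±1`; `gens_induction` = induction over generator steps from a base vertex
  (`dsGraph_connected`, `S = −S`).
[cite: KozmaNitzan2024, §4 p. 15–16 (the role of the lattice symmetries; Lemma 8)] [cite: BenjaminiSchramm1996, Conj. 4]
-/

namespace Summit.CriticalPhenomena.PercolationContinuityZ3.Theorems.Transplant

namespace DecoratedSlab

open Literature.Probability.LatticeModels Literature.Probability.Percolation.GM SimpleGraph

/-! ## §1 The three intrinsic edge types -/

/-- The `y`-generator `(e₁, 0)`. [folklore] -/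
def Yg : DS := (ev 1, 0)

/-- The `x`-generator `(e₀, 0)`. [folklore] -/
def Xg : DS := (ev 0, 0)

/-- The rung `f = (0, 1)`. [folklore] -/
def Rg : DS := (0, 1)

/-- `u ∼ u + s ↔ s ∈ S`. [folklore] -/
theorem adj_add_iff (u s : DS) : dsGraph.Adj u (u + s) ↔ s ∈ dsGens := by
  rw [dsGraph_adj_iff, add_sub_cancel_left]

/-- (F1) no two generators differ by `±e₁`: the `e₁`-edges lie in no triangle. [folklore] -/
theorem gens_sub_ne_Yg : ∀ s ∈ dsGens, ∀ s' ∈ dsGens, s - s' ≠ Yg ∧ s - s' ≠ -Yg := by decide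

/-- (F2) every other generator `d` has a generator `s` with `s - d ∈ S` (a common neighbour `u + s` of `u`, `u + d`). [folklore] -/
theorem gens_common_of_ne_Yg : ∀ d ∈ dsGens, d ≠ Yg → d ≠ -Yg → ∃ s ∈ dsGens, s - d ∈ dsGens := by decide

/-- (F3) for an `x`-type generator `d` (`d.1 0 ≠ 0`) any two common neighbours of `u`, `u + d` coincide or are adjacent. [folklore] -/
theorem gens_xtype_common_adj : ∀ d ∈ dsGens, d.1 0 ≠ 0 → ∀ s₁ ∈ dsGens, ∀ s₂ ∈ dsGens,
    s₁ - d ∈ dsGens → s₂ - d ∈ dsGens → s₁ = s₂ ∨ s₂ - s₁ ∈ dsGens := by decide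

/-- (F4) the rung `u ∼ u + f` has the two non-adjacent common neighbours `u ± e₀`. [folklore] -/
theorem rung_facts : Xg ∈ dsGens ∧ Xg - Rg ∈ dsGens ∧ -Xg ∈ dsGens ∧ -Xg - Rg ∈ dsGens ∧ Xg ≠ -Xg ∧ -Xg - Xg ∉ dsGens := by decide

/-- (F5) the generators with no `x`-displacement are `±e₁` and `f`. [folklore] -/
theorem gens_fst_zero : ∀ d ∈ dsGens, d.1 0 = 0 → d = Yg ∨ d = -Yg ∨ d = Rg := by decide

/-- (F6) generators other than `±e₁` have no `y`-displacement; `x`-displacements are `±1`. [folklore] -/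
theorem gens_snd_zero : ∀ d ∈ dsGens, d ≠ Yg → d ≠ -Yg → d.1 1 = 0 := by decide

/-- (F6') `x`-type generators move `x` by `±1` and are not `±e₁`, `f`. [folklore] -/
theorem gens_xtype : ∀ d ∈ dsGens, d.1 0 ≠ 0 → (d.1 0 = 1 ∨ d.1 0 = -1) ∧ d ≠ Yg ∧ d ≠ -Yg ∧ d ≠ Rg := by decide

/-- (F6'') the four `x`-type generators. [folklore] -/
theorem gens_xtype_cases : ∀ s ∈ dsGens, s.1 0 ≠ 0 → s = Xg ∨ s = -Xg ∨ s = Xg + Rg ∨ s = -Xg + Rg := by decide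

/-- (F7) small facts about the three named generators. [folklore] -/
theorem named_facts : Yg ∈ dsGens ∧ Rg ∈ dsGens ∧ Xg + Xg ∉ dsGens ∧ Xg + Xg ≠ 0 ∧ Yg + Yg ≠ 0 ∧ Rg ≠ Yg ∧ Rg ≠ -Yg ∧
    Yg.1 1 = 1 ∧ (-Yg).1 1 = -1 ∧ Yg.1 0 = 0 ∧ (-Yg).1 0 = 0 ∧ Rg.1 0 = 0 ∧ Rg.1 1 = 0 ∧ Xg.1 0 = 1 ∧ Xg.1 1 = 0 ∧ Xg.1 0 ≠ 0 ∧
    Rg.1 = 0 ∧ Yg + Yg = (Pi.single 1 2, 0) ∧ Xg + Xg = (Pi.single 0 2, 0) := by decide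

/-- Two vertices over the same plane point are equal or joined by a rung. [folklore] -/
theorem sub_eq_zero_or_Rg {a b : DS} (h : b.1 = a.1) : b - a = 0 ∨ b - a = Rg := by
  rcases (by decide : ∀ z : ZMod 2, z = 0 ∨ z = 1) (b.2 - a.2) with hz | hz
  · left; ext i <;> simp [h, hz]
  · right; ext i <;> simp [h, hz, Rg]

/-! ## §2 Automorphisms act affinely on the plane coordinates -/

section Aut

variable (α : dsGraph ≃g dsGraph)

/-- A common neighbour. [folklore] -/
def HasCommon (u v : DS) : Prop := ∃ z, dsGraph.Adj u z ∧ dsGraph.Adj v z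

/-- Two distinct, non-adjacent common neighbours. [folklore] -/
def TwoFar (u v : DS) : Prop := ∃ z₁ z₂, dsGraph.Adj u z₁ ∧ dsGraph.Adj v z₁ ∧ dsGraph.Adj u z₂ ∧ dsGraph.Adj v z₂ ∧ z₁ ≠ z₂ ∧ ¬ dsGraph.Adj z₁ z₂

/-- `HasCommon u (u + d)` in terms of generators. [folklore] -/
theorem hasCommon_add_iff (u d : DS) : HasCommon u (u + d) ↔ ∃ s ∈ dsGens, s - d ∈ dsGens := by
  constructor
  · rintro ⟨z, h1, h2⟩
    refine ⟨z - u, (dsGraph_adj_iff _ _).1 h1, ?_⟩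
    rw [dsGraph_adj_iff] at h2
    have : z - u - d = z - (u + d) := by abel
    rw [this]; exact h2
  · rintro ⟨s, hs, hsd⟩
    refine ⟨u + s, (adj_add_iff u s).2 hs, ?_⟩
    rw [dsGraph_adj_iff]
    have : u + s - (u + d) = s - d := by abel
    rw [this]; exact hsd

omit α in
/-- Automorphisms preserve common neighbours. [folklore] -/
theorem hasCommon_map (α : dsGraph ≃g dsGraph) {u v : DS} (h : HasCommon u v) : HasCommon (α u) (α v) := by
  obtain ⟨z, h1, h2⟩ := h
  exact ⟨α z, α.map_adj_iff.2 h1, α.map_adj_iff.2 h2⟩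

omit α in
/-- … and reflect them. [folklore] -/
theorem hasCommon_of_map (α : dsGraph ≃g dsGraph) {u v : DS} (h : HasCommon (α u) (α v)) : HasCommon u v := by
  obtain ⟨z, h1, h2⟩ := h
  refine ⟨α.symm z, ?_, ?_⟩
  · have := α.symm.map_adj_iff.2 h1; rwa [α.symm_apply_apply] at this
  · have := α.symm.map_adj_iff.2 h2; rwa [α.symm_apply_apply] at this

omit α in
/-- Automorphisms preserve pairs of distinct non-adjacent common neighbours. [folklore] -/
theorem twoFar_map (α : dsGraph ≃g dsGraph) {u v : DS} (h : TwoFar u v) : TwoFar (α u) (α v) := by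
  obtain ⟨z₁, z₂, h1, h2, h3, h4, hne, hna⟩ := h
  exact ⟨α z₁, α z₂, α.map_adj_iff.2 h1, α.map_adj_iff.2 h2, α.map_adj_iff.2 h3, α.map_adj_iff.2 h4,
    fun heq => hne (α.injective heq), fun ha => hna (α.map_adj_iff.1 ha)⟩

omit α in
/-- … and reflect them. [folklore] -/
theorem twoFar_of_map (α : dsGraph ≃g dsGraph) {u v : DS} (h : TwoFar (α u) (α v)) : TwoFar u v := by
  have h' := twoFar_map α.symm h
  rwa [α.symm_apply_apply, α.symm_apply_apply] at h'

/-- `e₁`-edges have no common neighbour. [folklore] -/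
theorem not_hasCommon_Yg (u : DS) {d : DS} (hd : d = Yg ∨ d = -Yg) : ¬ HasCommon u (u + d) := by
  rw [hasCommon_add_iff]
  rintro ⟨s, hs, hsd⟩
  have h := gens_sub_ne_Yg s hs (s - d) hsd
  rw [sub_sub_cancel] at h
  rcases hd with rfl | rfl
  · exact h.1 rfl
  · exact h.2 rfl

/-- The rung `u ∼ u + f` has two distinct non-adjacent common neighbours. [folklore] -/
theorem twoFar_Rg (u : DS) : TwoFar u (u + Rg) := by
  obtain ⟨h1, h2, h3, h4, hne, hna⟩ := rung_facts
  refine ⟨u + Xg, u + -Xg, (adj_add_iff u _).2 h1, ?_, (adj_add_iff u _).2 h3, ?_, fun h => hne (add_left_cancel h), ?_⟩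
  · rw [dsGraph_adj_iff, show u + Xg - (u + Rg) = Xg - Rg by abel]; exact h2
  · rw [dsGraph_adj_iff, show u + -Xg - (u + Rg) = -Xg - Rg by abel]; exact h4
  · rw [dsGraph_adj_iff, show u + -Xg - (u + Xg) = -Xg - Xg by abel]; exact hna

/-- `x`-type edges have no two distinct non-adjacent common neighbours. [folklore] -/
theorem not_twoFar_xtype (u : DS) {d : DS} (hd : d ∈ dsGens) (hx : d.1 0 ≠ 0) : ¬ TwoFar u (u + d) := by
  rintro ⟨z₁, z₂, h1, h2, h3, h4, hne, hna⟩
  rw [dsGraph_adj_iff] at h1 h2 h3 h4 hna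
  have e2 : z₁ - (u + d) = (z₁ - u) - d := by abel
  have e4 : z₂ - (u + d) = (z₂ - u) - d := by abel
  rw [e2] at h2; rw [e4] at h4
  rcases gens_xtype_common_adj d hd hx (z₁ - u) h1 (z₂ - u) h3 h2 h4 with h | h
  · exact hne (sub_left_injective h)
  · apply hna; rw [show z₂ - z₁ = z₂ - u - (z₁ - u) by abel]; exact h

/-- The step of `α` along `s` at `w`: `α (w + s) - α w`, a generator whenever `s` is. [folklore] -/
theorem step_mem {w s : DS} (hs : s ∈ dsGens) : α (w + s) - α w ∈ dsGens :=
  (dsGraph_adj_iff _ _).1 (α.map_adj_iff.2 ((adj_add_iff w s).2 hs))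

/-- **`e₁`-steps go to `±e₁`-steps.** [folklore] -/
theorem step_Yg (w : DS) : α (w + Yg) - α w = Yg ∨ α (w + Yg) - α w = -Yg := by
  have hd := step_mem α (w := w) named_facts.1
  by_cases h1 : α (w + Yg) - α w = Yg
  · exact Or.inl h1
  by_cases h2 : α (w + Yg) - α w = -Yg
  · exact Or.inr h2
  exfalso
  obtain ⟨s, hs, hsd⟩ := gens_common_of_ne_Yg _ hd h1 h2
  have hc : HasCommon (α w) (α w + (α (w + Yg) - α w)) := (hasCommon_add_iff _ _).2 ⟨s, hs, hsd⟩
  rw [add_sub_cancel] at hc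
  exact not_hasCommon_Yg w (Or.inl rfl) (hasCommon_of_map α hc)

/-- The sign of the `e₁`-steps is the same at `w` and `w + e₁` (injectivity). [folklore] -/
theorem step_Yg_succ (w : DS) : α (w + Yg + Yg) - α (w + Yg) = α (w + Yg) - α w := by
  rcases step_Yg α w with h0 | h0 <;> rcases step_Yg α (w + Yg) with h1 | h1 <;> rw [h0, h1]
  · exfalso
    have : α (w + Yg + Yg) = α w := by
      have e : α (w + Yg + Yg) = (α (w + Yg + Yg) - α (w + Yg)) + (α (w + Yg) - α w) + α w := by abel
      rw [e, h0, h1]; abel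
    have := α.injective this
    rw [add_assoc, add_eq_left] at this
    exact named_facts.2.2.2.2.1 this
  · exfalso
    have : α (w + Yg + Yg) = α w := by
      have e : α (w + Yg + Yg) = (α (w + Yg + Yg) - α (w + Yg)) + (α (w + Yg) - α w) + α w := by abel
      rw [e, h0, h1]; abel
    have := α.injective this
    rw [add_assoc, add_eq_left] at this
    exact named_facts.2.2.2.2.1 this

/-- **Non-`e₁` steps keep the `y`-coordinate.** [folklore] -/
theorem snd_step_of_ne_Yg (w : DS) {s : DS} (hs : s ∈ dsGens) (h1 : s ≠ Yg) (h2 : s ≠ -Yg) : (α (w + s)).1 1 = (α w).1 1 := by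
  have hd := step_mem α (w := w) hs
  have hc : HasCommon (α w) (α (w + s)) := hasCommon_map α ((hasCommon_add_iff w s).2 (gens_common_of_ne_Yg s hs h1 h2))
  have hne : α (w + s) - α w ≠ Yg ∧ α (w + s) - α w ≠ -Yg := by
    constructor <;> intro h <;> refine not_hasCommon_Yg (α w) (d := α (w + s) - α w) ?_ (by rwa [add_sub_cancel])
    · exact Or.inl h
    · exact Or.inr h
  have h0 := gens_snd_zero _ hd hne.1 hne.2
  have : (α (w + s) - α w).1 1 = (α (w + s)).1 1 - (α w).1 1 := rfl
  rw [this] at h0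
  linarith

/-- The sign of the `e₁`-steps is the same at `w` and `w + s` for a non-`e₁` generator `s` (a 4-cycle). [folklore] -/
theorem step_Yg_side (w : DS) {s : DS} (hs : s ∈ dsGens) (h1 : s ≠ Yg) (h2 : s ≠ -Yg) :
    α (w + s + Yg) - α (w + s) = α (w + Yg) - α w := by
  -- compare `y`-coordinates: both differences are `±e₁`
  have hy1 : (α (w + s + Yg)).1 1 = (α (w + Yg)).1 1 := by
    rw [show w + s + Yg = w + Yg + s by abel]; exact snd_step_of_ne_Yg α (w + Yg) hs h1 h2
  have hy2 : (α (w + s)).1 1 = (α w).1 1 := snd_step_of_ne_Yg α w hs h1 h2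
  have key : (α (w + s + Yg) - α (w + s)).1 1 = (α (w + Yg) - α w).1 1 := by
    show (α (w + s + Yg)).1 1 - (α (w + s)).1 1 = (α (w + Yg)).1 1 - (α w).1 1
    rw [hy1, hy2]
  obtain ⟨-, -, -, -, -, -, -, hY1, hY2, -⟩ := named_facts
  rcases step_Yg α (w + s) with ha | ha <;> rcases step_Yg α w with hb | hb <;> rw [ha, hb] at key ⊢
  · rw [hY1, hY2] at key; norm_num at key
  · rw [hY1, hY2] at key; norm_num at key

/-- Induction over the generators from a base vertex (the graph is connected and `S = -S`). [folklore] -/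
theorem gens_induction {P : DS → Prop} (t : DS) (h0 : P t) (hstep : ∀ w, ∀ s ∈ dsGens, P w → P (w + s)) : ∀ w, P w := by
  intro w
  obtain ⟨p⟩ := dsGraph_connected.preconnected t w
  induction p with
  | nil => exact h0
  | @cons a b c hab _ ih =>
    have hs : b - a ∈ dsGens := (dsGraph_adj_iff _ _).1 hab
    have := hstep a (b - a) hs ?_
    · rw [add_sub_cancel] at this; exact ih this
    · exact h0

/-- **The `e₁`-step of `α` is one global vector `±e₁`.** [folklore] -/
theorem step_Yg_const (t w : DS) : α (w + Yg) - α w = α (t + Yg) - α t := by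
  refine gens_induction (P := fun w => α (w + Yg) - α w = α (t + Yg) - α t) t rfl (fun w s hs hw => ?_) w
  by_cases h1 : s = Yg
  · subst h1; rw [step_Yg_succ]; exact hw
  by_cases h2 : s = -Yg
  · subst h2
    have e := step_Yg_succ α (w + -Yg)
    rw [show w + -Yg + Yg = w by abel] at e
    rw [show w + -Yg + Yg = w by abel, ← e]; exact hw
  · rw [step_Yg_side α w hs h1 h2]; exact hw

/-- **The `y`-coordinate is affine under `α`**: `y(α w) - y(α t) = σ (y w - y t)` with `σ = y(α (t+e₁) - α t) = ±1`. [folklore] -/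
theorem snd_aut_affine (t w : DS) : (α w).1 1 - (α t).1 1 = (α (t + Yg) - α t).1 1 * (w.1 1 - t.1 1) := by
  refine gens_induction (P := fun w => (α w).1 1 - (α t).1 1 = (α (t + Yg) - α t).1 1 * (w.1 1 - t.1 1)) t (by simp)
    (fun w s hs hw => ?_) w
  obtain ⟨-, -, -, -, -, -, -, hY1, hY2, -⟩ := named_facts
  by_cases h1 : s = Yg
  · subst h1
    have e := step_Yg_const α t w
    have e1 : (α (w + Yg)).1 1 = (α w).1 1 + (α (t + Yg) - α t).1 1 := by
      have : (α (w + Yg) - α w).1 1 = (α (t + Yg) - α t).1 1 := by rw [e]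
      have : (α (w + Yg)).1 1 - (α w).1 1 = (α (t + Yg) - α t).1 1 := this
      linarith
    have e2 : (w + Yg).1 1 = w.1 1 + 1 := by show w.1 1 + Yg.1 1 = _; rw [hY1]
    rw [e1, e2]; linarith
  by_cases h2 : s = -Yg
  · subst h2
    have e := step_Yg_const α t (w + -Yg)
    rw [show w + -Yg + Yg = w by abel] at e
    have e1 : (α (w + -Yg)).1 1 = (α w).1 1 - (α (t + Yg) - α t).1 1 := by
      have : (α w - α (w + -Yg)).1 1 = (α (t + Yg) - α t).1 1 := by rw [e]
      have : (α w).1 1 - (α (w + -Yg)).1 1 = (α (t + Yg) - α t).1 1 := this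
      linarith
    have e2 : (w + -Yg).1 1 = w.1 1 - 1 := by show w.1 1 + (-Yg).1 1 = _; rw [hY2]; ring
    rw [e1, e2]; linarith
  · have e1 := snd_step_of_ne_Yg α w hs h1 h2
    have e2 : (w + s).1 1 = w.1 1 := by
      show w.1 1 + s.1 1 = _; rw [gens_snd_zero s hs h1 h2, add_zero]
    rw [e1, e2]; exact hw

end Aut

end DecoratedSlab

end Summit.CriticalPhenomena.PercolationContinuityZ3.Theorems.Transplant
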